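import Mathlib
import Literature.Computability.AlgebraicComplexity.SecondFundamentalTheoremGL
import Summits.MatrixMultiplication.MatrixMultiplication.Theorems.LevelOneGL2Designs.Negative.LevelSpace
import Summits.MatrixMultiplication.MatrixMultiplication.Theorems.SubgroupIdentityDesigns.Negative.FrameGhost
import Summits.MatrixMultiplication.MatrixMultiplication.Theorems.SubgroupIdentityDesigns.Negative.LineStabilizer

/-!
# A small spanning set of the level-one space `F_1|_{GL_m(𝔽_p)}`
(support lemma for the crux `SubgroupIdentityDesigns`, stmt-MatrixMultiplication-14079; cell B2b-5
`b2b-lgcu-borel`, gen 11 — report `run/shared/lean/b2b/levelgraded-cu/ORACLE-g11.md` §G11-3f)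

By `FrameGhost` the level-one test space `F_1|_G`, `G = GL_m(𝔽_p)`, is spanned by the VECTOR
TRANSPORT indicators `t_{u,a} : g ↦ [g u = a]` (`u, a ∈ 𝔽_p^m`).  They satisfy
`t_{λu,λa} = t_{u,a}`, the ROW relations `Σ_a t_{u,a} = 1` and the COLUMN relations
`Σ_{[u]} Σ_λ t_{rep[u], λa} = 1` (`col_sum_eq_one`).  Consequently (`levelSubmodule_le_of_generators`)
`F_1|_G` lies in ANY submodule containing the constant `1` and the transports `t_{rep ℓ, a}` with
`a ≠ 0`, `a ≠ a₀`, except those with `ℓ = ℓ₀ = [a₀]` and `a` the chosen representative of a line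
`≠ ℓ₀` — i.e. after deleting one transport per row and one per column class.  Counting them
(`Negative/LevelOneDim.lean`) gives `dim F_1|_G ≤ 1 + a² + (p−2) b²`, the sum of the squares of
the degrees of `1`, `Ind_P^G 1 − 1`, `π_χ` — the exact dimension, which sharpens the wall ceiling
of the level-one squeeze to its true value (`Negative/LevelOneDimSqueeze.lean`).
Sorry-free.  VALUE = theorem (structure of `F_1`), NOT summit progress; the crux item stays open.
-/

set_option linter.dupNamespace false

noncomputable section

open scoped BigOperators Classical Matrix LinearAlgebra.Projectivization

namespace Summit.MatrixMultiplication.MatrixMultiplication.Theorems.SubgroupIdentityDesigns.Negative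
namespace VectorTransportSpan

open Summit.MatrixMultiplication.MatrixMultiplication.Theorems.LieRankDesigns.Negative
  (GLm Mat fourierFn RankSupp)
open Summit.MatrixMultiplication.MatrixMultiplication.Theorems.LevelOneGL2Designs.Negative
  (levelSubmodule mem_levelSubmodule_iff)
open Literature.Computability.AlgebraicComplexity (exists_eq_mul_of_rank_le)
open FrameGhost (wave_eq_sum_transport)
open LineStabilizer (mulVec_eq_iff)

variable {p m : ℕ} [hp : Fact p.Prime]

/-! ## The column relation -/

/-- For `a ≠ 0` and `g ∈ GL_m`: exactly one pair (line `ℓ`, unit `μ`) has `g · rep ℓ = μ a`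
(namely `ℓ = [g⁻¹ a]`), so `Σ_{ℓ, μ} [g · rep ℓ = μ a] = 1`. -/
theorem col_sum_eq_one {a : Fin m → ZMod p} (ha : a ≠ 0) (g : GLm p m)
    (s : Finset (ℙ (ZMod p) (Fin m → ZMod p) × (ZMod p)ˣ)) (hs : ∀ x, x ∈ s) :
    (∑ x ∈ s, if (g : Mat p m) *ᵥ x.1.rep = (x.2 : ZMod p) • a then (1 : ℂ) else 0) = 1 := by
  set u₀ : Fin m → ZMod p := ((g⁻¹ : GLm p m) : Mat p m) *ᵥ a with hu₀_def
  have hgu₀ : (g : Mat p m) *ᵥ u₀ = a := by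
    rw [hu₀_def, Matrix.mulVec_mulVec, ← Units.val_mul, mul_inv_cancel, Units.val_one,
      Matrix.one_mulVec]
  have hu₀ : u₀ ≠ 0 := by
    intro h0
    apply ha
    rw [← hgu₀, h0, Matrix.mulVec_zero]
  obtain ⟨μ, hμ⟩ := Projectivization.exists_smul_eq_mk_rep (ZMod p) u₀ hu₀
  have key : ∀ x : ℙ (ZMod p) (Fin m → ZMod p) × (ZMod p)ˣ,
      ((g : Mat p m) *ᵥ x.1.rep = (x.2 : ZMod p) • a) ↔
        x = (Projectivization.mk (ZMod p) u₀ hu₀, μ) := by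
    intro x
    constructor
    · intro h
      have h1 : x.1.rep = (x.2 : ZMod p) • u₀ := by
        rw [mulVec_eq_iff] at h
        rw [h, Matrix.mulVec_smul]
      have hx1 : x.1 = Projectivization.mk (ZMod p) u₀ hu₀ := by
        rw [← Projectivization.mk_rep x.1, Projectivization.mk_eq_mk_iff]
        exact ⟨x.2, by rw [Units.smul_def, h1]⟩
      have hx2 : x.2 = μ := by
        have e : (x.2 : ZMod p) • u₀ = (μ : ZMod p) • u₀ := by
          rw [← h1, hx1, ← Units.smul_def, hμ]
        have e2 : ((x.2 : ZMod p) - μ) • u₀ = 0 := by rw [sub_smul, e, sub_self]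
        rcases smul_eq_zero.mp e2 with h3 | h3
        · exact Units.ext (sub_eq_zero.mp h3)
        · exact absurd h3 hu₀
      exact Prod.ext hx1 hx2
    · rintro rfl
      show (g : Mat p m) *ᵥ (Projectivization.mk (ZMod p) u₀ hu₀).rep = (μ : ZMod p) • a
      rw [← hμ, Units.smul_def, Matrix.mulVec_smul, hgu₀]
  simp_rw [key]
  rw [Finset.sum_ite_eq' s]
  rw [if_pos (hs _)]

/-! ## Generators after row and column deletion -/

/-- **ROW AND COLUMN DELETION.**  Fix `a₀ ≠ 0`, `ℓ₀ = [a₀]`.  If a submodule `S` of functions on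
`GL_m(𝔽_p)` contains the constant `1` and every transport `t_{rep ℓ, a}` with `a ≠ 0`, `a ≠ a₀` and
NOT (`ℓ = ℓ₀` and `a = rep ℓ'` for a line `ℓ' ≠ ℓ₀`), then it contains every `t_{rep ℓ, a}`, `a ≠ 0`
(the deleted ones are recovered from the column relations, then the row relations). -/
theorem transport_rep_mem {S : Submodule ℂ (GLm p m → ℂ)} {a₀ : Fin m → ZMod p} (ha₀ : a₀ ≠ 0)
    (h1 : (fun _ : GLm p m => (1 : ℂ)) ∈ S)
    (hgen : ∀ (ℓ : ℙ (ZMod p) (Fin m → ZMod p)) (a : Fin m → ZMod p), a ≠ 0 → a ≠ a₀ →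
      ¬ (ℓ = Projectivization.mk (ZMod p) a₀ ha₀ ∧
          ∃ ℓ' : ℙ (ZMod p) (Fin m → ZMod p), ℓ' ≠ Projectivization.mk (ZMod p) a₀ ha₀ ∧ ℓ'.rep = a) →
      (fun g : GLm p m => if (g : Mat p m) *ᵥ ℓ.rep = a then (1 : ℂ) else 0) ∈ S)
    (ℓ : ℙ (ZMod p) (Fin m → ZMod p)) {a : Fin m → ZMod p} (ha : a ≠ 0) :
    (fun g : GLm p m => if (g : Mat p m) *ᵥ ℓ.rep = a then (1 : ℂ) else 0) ∈ S := by
  haveI : Fintype (ℙ (ZMod p) (Fin m → ZMod p)) := Fintype.ofFinite _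
  set ℓ₀ := Projectivization.mk (ZMod p) a₀ ha₀ with hℓ₀_def
  -- (1) the column-deleted transports `t_{rep ℓ₀, rep ℓ'}`, `ℓ' ≠ ℓ₀`
  have hcol : ∀ ℓ' : ℙ (ZMod p) (Fin m → ZMod p), ℓ' ≠ ℓ₀ →
      (fun g : GLm p m => if (g : Mat p m) *ᵥ ℓ₀.rep = ℓ'.rep then (1 : ℂ) else 0) ∈ S := by
    intro ℓ' hℓ'
    set e : ℙ (ZMod p) (Fin m → ZMod p) × (ZMod p)ˣ := (ℓ₀, 1) with he_def
    have hfun : (fun g : GLm p m => if (g : Mat p m) *ᵥ ℓ₀.rep = ℓ'.rep then (1 : ℂ) else 0) =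
        (fun _ : GLm p m => (1 : ℂ)) -
          ∑ x ∈ Finset.univ.erase e,
            (fun g : GLm p m =>
              if (g : Mat p m) *ᵥ x.1.rep = (x.2 : ZMod p) • ℓ'.rep then (1 : ℂ) else 0) := by
      funext g
      have hc := col_sum_eq_one (ℓ'.rep_nonzero) g Finset.univ (fun x => Finset.mem_univ x)
      rw [← Finset.add_sum_erase _ _ (Finset.mem_univ e)] at hc
      simp only [he_def, Units.val_one, one_smul] at hc
      simp only [Pi.sub_apply, Finset.sum_apply, he_def]
      exact eq_sub_of_add_eq hc
    rw [hfun]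
    refine S.sub_mem h1 (Submodule.sum_mem _ fun x hx => ?_)
    have hxe : x ≠ e := Finset.ne_of_mem_erase hx
    have hxa : (x.2 : ZMod p) • ℓ'.rep ≠ 0 := by
      rw [← Units.smul_def]
      intro h0
      apply ℓ'.rep_nonzero
      have := congr_arg (fun w => x.2⁻¹ • w) h0
      simpa only [inv_smul_smul, smul_zero] using this
    -- `[x.2 • rep ℓ'] = ℓ'`
    have hmk : Projectivization.mk (ZMod p) ((x.2 : ZMod p) • ℓ'.rep) hxa = ℓ' := by
      conv_rhs => rw [← Projectivization.mk_rep ℓ']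
      rw [Projectivization.mk_eq_mk_iff]
      exact ⟨x.2, Units.smul_def _ _⟩
    apply hgen x.1 _ hxa
    · -- `x.2 • rep ℓ' ≠ a₀` since `[x.2 • rep ℓ'] = ℓ' ≠ ℓ₀ = [a₀]`
      intro h
      apply hℓ'
      rw [← hmk, hℓ₀_def]
      congr 1
    · rintro ⟨hx1, ℓ'', hℓ'', hrep''⟩
      -- `ℓ'' = ℓ'`, so `rep ℓ' = x.2 • rep ℓ'`, so `x.2 = 1`, so `x = e`
      have h'' : ℓ'' = ℓ' := by
        rw [← Projectivization.mk_rep ℓ'', ← hmk]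
        congr 1
      rw [h''] at hrep''
      have hx2 : x.2 = 1 := by
        have e2 : ((x.2 : ZMod p) - 1) • ℓ'.rep = 0 := by rw [sub_smul, one_smul, ← hrep'', sub_self]
        rcases smul_eq_zero.mp e2 with h3 | h3
        · exact Units.ext (by rw [Units.val_one]; exact sub_eq_zero.mp h3)
        · exact absurd h3 ℓ'.rep_nonzero
      exact hxe (Prod.ext hx1 hx2)
  -- (2) every transport with `a ≠ 0`, `a ≠ a₀`
  have hne : ∀ (ℓ₁ : ℙ (ZMod p) (Fin m → ZMod p)) (a₁ : Fin m → ZMod p), a₁ ≠ 0 → a₁ ≠ a₀ →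
      (fun g : GLm p m => if (g : Mat p m) *ᵥ ℓ₁.rep = a₁ then (1 : ℂ) else 0) ∈ S := by
    intro ℓ₁ a₁ ha₁ ha₁₀
    by_cases hc : ℓ₁ = ℓ₀ ∧ ∃ ℓ' : ℙ (ZMod p) (Fin m → ZMod p), ℓ' ≠ ℓ₀ ∧ ℓ'.rep = a₁
    · obtain ⟨rfl, ℓ', hℓ', rfl⟩ := hc
      exact hcol ℓ' hℓ'
    · exact hgen ℓ₁ a₁ ha₁ ha₁₀ hc
  -- (3) the row-deleted transports `t_{rep ℓ, a₀}` from the row relation `Σ_a t_{rep ℓ, a} = 1`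
  by_cases haa : a = a₀
  · subst haa
    have hfun : (fun g : GLm p m => if (g : Mat p m) *ᵥ ℓ.rep = a then (1 : ℂ) else 0) =
        (fun _ : GLm p m => (1 : ℂ)) -
          ∑ a' ∈ Finset.univ.erase a,
            (fun g : GLm p m => if (g : Mat p m) *ᵥ ℓ.rep = a' then (1 : ℂ) else 0) := by
      funext g
      have hr : (∑ a' : Fin m → ZMod p, if (g : Mat p m) *ᵥ ℓ.rep = a' then (1 : ℂ) else 0) = 1 :=
        by rw [Finset.sum_ite_eq, if_pos (Finset.mem_univ _)]
      rw [← Finset.add_sum_erase _ _ (Finset.mem_univ a)] at hr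
      simp only [Pi.sub_apply, Finset.sum_apply]
      exact eq_sub_of_add_eq hr
    rw [hfun]
    refine S.sub_mem h1 (Submodule.sum_mem _ fun a' ha' => ?_)
    have ha'a : a' ≠ a := Finset.ne_of_mem_erase ha'
    by_cases ha'0 : a' = 0
    · -- `t_{u,0} = 0` on `GL_m`
      have hz : (fun g : GLm p m => if (g : Mat p m) *ᵥ ℓ.rep = a' then (1 : ℂ) else 0) = 0 := by
        funext g
        rw [Pi.zero_apply, if_neg]
        rw [ha'0, mulVec_eq_iff, Matrix.mulVec_zero]
        exact ℓ.rep_nonzero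
      rw [hz]
      exact S.zero_mem
    · exact hne ℓ a' ha'0 ha'a
  · exact hne ℓ a ha haa

/-- From line representatives to all vectors: `t_{u,a} ∈ S` for every `u, a` (`t_{0,a}` is a
constant, `t_{u,0} = 0`, and `t_{u,a} = t_{rep[u], μ a}` for the unit `μ` with `μ u = rep [u]`). -/
theorem transport_mem {S : Submodule ℂ (GLm p m → ℂ)}
    (h1 : (fun _ : GLm p m => (1 : ℂ)) ∈ S)
    (hrep : ∀ (ℓ : ℙ (ZMod p) (Fin m → ZMod p)) (a : Fin m → ZMod p), a ≠ 0 →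
      (fun g : GLm p m => if (g : Mat p m) *ᵥ ℓ.rep = a then (1 : ℂ) else 0) ∈ S)
    (u a : Fin m → ZMod p) :
    (fun g : GLm p m => if (g : Mat p m) *ᵥ u = a then (1 : ℂ) else 0) ∈ S := by
  by_cases hu : u = 0
  · subst hu
    by_cases ha : a = 0
    · subst ha
      have : (fun g : GLm p m => if (g : Mat p m) *ᵥ (0 : Fin m → ZMod p) = 0 then (1 : ℂ) else 0) =
          fun _ => (1 : ℂ) := by
        funext g; rw [if_pos (Matrix.mulVec_zero _)]
      rw [this]; exact h1
    · have : (fun g : GLm p m => if (g : Mat p m) *ᵥ (0 : Fin m → ZMod p) = a then (1 : ℂ) else 0) =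
          0 := by
        funext g; rw [Matrix.mulVec_zero, if_neg (Ne.symm ha), Pi.zero_apply]
      rw [this]; exact S.zero_mem
  by_cases ha : a = 0
  · subst ha
    have : (fun g : GLm p m => if (g : Mat p m) *ᵥ u = 0 then (1 : ℂ) else 0) = 0 := by
      funext g
      rw [Pi.zero_apply, if_neg]
      rw [mulVec_eq_iff, Matrix.mulVec_zero]
      exact hu
    rw [this]; exact S.zero_mem
  obtain ⟨μ, hμ⟩ := Projectivization.exists_smul_eq_mk_rep (ZMod p) u hu
  have hμa : μ • a ≠ 0 := by
    intro h0
    apply ha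
    have := congr_arg (fun w => μ⁻¹ • w) h0
    simpa only [inv_smul_smul, smul_zero] using this
  have key := hrep (Projectivization.mk (ZMod p) u hu) (μ • a) hμa
  have hfun : (fun g : GLm p m => if (g : Mat p m) *ᵥ u = a then (1 : ℂ) else 0) =
      fun g : GLm p m =>
        if (g : Mat p m) *ᵥ (Projectivization.mk (ZMod p) u hu).rep = μ • a then (1 : ℂ) else 0 := by
    funext g
    have hiff : (g : Mat p m) *ᵥ u = a ↔
        (g : Mat p m) *ᵥ (Projectivization.mk (ZMod p) u hu).rep = μ • a := by
      rw [← hμ, Units.smul_def, Units.smul_def, Matrix.mulVec_smul]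
      constructor
      · intro h; rw [h]
      · intro h
        have := congr_arg (fun w => (μ⁻¹ : (ZMod p)ˣ) • w) h
        simpa only [← Units.smul_def, inv_smul_smul] using this
    simp only [hiff]
  rw [hfun]
  exact key

/-! ## `F_1|_G` lies in the span -/

/-- Matrix form versus vector form of a transport condition for `m × 1` frames. -/
theorem mul_col_eq_iff (g : Mat p m) (U A : Matrix (Fin m) (Fin 1) (ZMod p)) :
    g * U = A ↔ g *ᵥ (fun i => U i 0) = fun i => A i 0 := by
  constructor
  · intro h
    funext i
    have := congr_fun (congr_fun h i) 0
    rw [Matrix.mul_apply] at this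
    simpa [Matrix.mulVec, dotProduct] using this
  · intro h
    ext i j
    have hj : j = 0 := Subsingleton.elim j 0
    subst hj
    have := congr_fun h i
    simp only [Matrix.mulVec, dotProduct] at this
    rw [Matrix.mul_apply]
    exact this

/-- **`F_1|_G` IS SPANNED BY VECTOR TRANSPORTS**: any submodule containing every
`t_{u,a} : g ↦ [g u = a]` contains the level-one space `levelSubmodule p m 1`. -/
theorem levelSubmodule_le_of_transport {S : Submodule ℂ (GLm p m → ℂ)}
    (h : ∀ u a : Fin m → ZMod p,
      (fun g : GLm p m => if (g : Mat p m) *ᵥ u = a then (1 : ℂ) else 0) ∈ S) :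
    levelSubmodule p m 1 ≤ S := by
  intro f hf
  obtain ⟨c, hc, hfc⟩ := mem_levelSubmodule_iff.mp hf
  have hfeq : f = ∑ M : Mat p m,
      c M • fun g : GLm p m => ZMod.stdAddChar (Matrix.trace (M * (g : Mat p m))) := by
    funext g
    rw [hfc g, Finset.sum_apply]
    simp only [fourierFn, Pi.smul_apply, smul_eq_mul]
  rw [hfeq]
  refine Submodule.sum_mem _ fun M _ => ?_
  by_cases hM : M.rank ≤ 1
  · refine S.smul_mem _ ?_
    obtain ⟨U, W, rfl⟩ := exists_eq_mul_of_rank_le M hM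
    have hw : (fun g : GLm p m => ZMod.stdAddChar (Matrix.trace (U * W * (g : Mat p m)))) =
        ∑ A : Matrix (Fin m) (Fin 1) (ZMod p),
          ZMod.stdAddChar (Matrix.trace (W * A)) •
            fun g : GLm p m =>
              if (g : Mat p m) *ᵥ (fun i => U i 0) = (fun i => A i 0) then (1 : ℂ) else 0 := by
      funext g
      rw [wave_eq_sum_transport, Finset.sum_apply]
      refine Finset.sum_congr rfl fun A _ => ?_
      simp only [Pi.smul_apply, smul_eq_mul, mul_ite, mul_one, mul_zero, mul_col_eq_iff]
    rw [hw]
    exact Submodule.sum_mem _ fun A _ => S.smul_mem _ (h _ _)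
  · rw [hc M (not_le.mp hM), zero_smul]
    exact S.zero_mem

/-- **THE DELETED GENERATING SET SPANS `F_1|_G`.**  For `a₀ ≠ 0`, `ℓ₀ = [a₀]`: any submodule
containing `1` and the transports `t_{rep ℓ, a}` (`a ≠ 0`, `a ≠ a₀`, not (`ℓ = ℓ₀` and `a = rep ℓ'`,
`ℓ' ≠ ℓ₀`)) contains `levelSubmodule p m 1`. -/
theorem levelSubmodule_le_of_generators {S : Submodule ℂ (GLm p m → ℂ)} {a₀ : Fin m → ZMod p}
    (ha₀ : a₀ ≠ 0) (h1 : (fun _ : GLm p m => (1 : ℂ)) ∈ S)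
    (hgen : ∀ (ℓ : ℙ (ZMod p) (Fin m → ZMod p)) (a : Fin m → ZMod p), a ≠ 0 → a ≠ a₀ →
      ¬ (ℓ = Projectivization.mk (ZMod p) a₀ ha₀ ∧
          ∃ ℓ' : ℙ (ZMod p) (Fin m → ZMod p), ℓ' ≠ Projectivization.mk (ZMod p) a₀ ha₀ ∧ ℓ'.rep = a) →
      (fun g : GLm p m => if (g : Mat p m) *ᵥ ℓ.rep = a then (1 : ℂ) else 0) ∈ S) :
    levelSubmodule p m 1 ≤ S :=
  levelSubmodule_le_of_transport
    (transport_mem h1 fun ℓ _ ha => transport_rep_mem ha₀ h1 hgen ℓ ha)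

end VectorTransportSpan
end Summit.MatrixMultiplication.MatrixMultiplication.Theorems.SubgroupIdentityDesigns.Negative
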